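import Summits.Ventures.Crystal3D.Theorems.StickyWulffConstantGenericWallFloorDoubleStarCoaxial
import HarnessLib

/-!
# `DoubleStarCoaxialAt`: the 10-star and the 24-ball handover forms are equivalent
# (crux `GenericWallFloor`, line `WallLedgerG`; interface note for R39d / wulff-p2's local lemmas)

HONEST FRAMING. Part of the venture `Summits/Ventures/Crystal3D` (cell `crystal3d-full`), helper
`--supports` the crux `GenericWallFloor` (stmt-Ventures-19480), registered line `WallLedgerG`, open stub
`stub_twoSlabAdhesion`.  Companion of `…DoubleStarCoaxial`: the certifier (wulff-p2 g9's joint-rigidity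
lemmas, eng/cf-p2's B&B R39d) may prefer the eleventh ball `y` to be assumed distinct from ALL 24
non-centre balls of the two predecessor clusters, not only from the ten star balls.  For a ball at
distance `1` from `e` the two are the same thing: a cluster ball `e − A u + A w` at distance `1` from `e`
has `w − u` a slot at `120°` from `u`, i.e. it IS a star ball (`cluster_ball_at_dist_one_is_star`).

* `DoubleStarCoaxialAt24 A₁ A₂` — the variant with `y` off all cluster balls;
* `doubleStarCoaxialAt_of_24 : DoubleStarCoaxialAt24 A₁ A₂ → DoubleStarCoaxialAt A₁ A₂` — so either
  form discharges the chain ledger's input (`twoSlabAdhesion_sealed_of_doubleStarCoaxial`).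

WHAT THIS IS NOT: no certificate; F-C1 not moved.
-/

noncomputable section

namespace Summit.Ventures.Crystal3D.Theorems

open Summit.Ventures.Crystal3D Finset
open Literature.MathematicalPhysics.StatisticalMechanics (fccStacking barlowStacking IsHaggSeq)
open scoped InnerProductSpace

/-- **A cluster ball at distance one from `e` is a star ball.**  If `dist e (e − A u + A w) = 1` for
slots `u, w`, then `w − u` is a slot with `⟪w − u, u⟫ < 0` and `e − A u + A w = e + A (w − u)`. -/
theorem cluster_ball_at_dist_one_is_star (A : EuclideanSpace ℝ (Fin 3) ≃ₗᵢ[ℝ] EuclideanSpace ℝ (Fin 3))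
    {u w : EuclideanSpace ℝ (Fin 3)} (hu : u ∈ fccSlots) (hw : w ∈ fccSlots) (e : EuclideanSpace ℝ (Fin 3))
    (hd : dist e (e - A u + A w) = 1) :
    w - u ∈ fccSlots ∧ ⟪w - u, u⟫_ℝ < 0 ∧ e - A u + A w = e + A (w - u) := by
  have hform : e - A u + A w = e + A (w - u) := by rw [map_sub]; abel
  have hnorm : ‖w - u‖ = 1 := by
    rw [hform, dist_eq_norm, show e - (e + A (w - u)) = -(A (w - u)) by abel, norm_neg,
      LinearIsometryEquiv.norm_map] at hd
    exact hd
  have huu : ⟪u, u⟫_ℝ = 1 := by rw [real_inner_self_eq_norm_sq, norm_eq_one_of_mem_fccSlots hu, one_pow]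
  have h1 : ‖w - u‖ ^ 2 = 2 - 2 * ⟪w, u⟫_ℝ := by
    rw [norm_sub_sq_real, norm_eq_one_of_mem_fccSlots hw, norm_eq_one_of_mem_fccSlots hu]; ring
  rw [hnorm, one_pow] at h1
  have hwu : ⟪w, u⟫_ℝ = 1 / 2 := by linarith
  refine ⟨sub_mem_fccSlots_of_inner_eq_half hw hu hwu, ?_, hform⟩
  rw [inner_sub_left, hwu, huu]; norm_num

/-- The predecessor itself is a star ball: `e − A u = e + A (−u)` with `⟪−u, u⟫ < 0`. -/
theorem pred_is_star (A : EuclideanSpace ℝ (Fin 3) ≃ₗᵢ[ℝ] EuclideanSpace ℝ (Fin 3))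
    {u : EuclideanSpace ℝ (Fin 3)} (hu : u ∈ fccSlots) (e : EuclideanSpace ℝ (Fin 3)) :
    -u ∈ fccSlots ∧ ⟪-u, u⟫_ℝ < 0 ∧ e - A u = e + A (-u) := by
  have huu : ⟪u, u⟫_ℝ = 1 := by rw [real_inner_self_eq_norm_sq, norm_eq_one_of_mem_fccSlots hu, one_pow]
  refine ⟨neg_mem_fccSlots hu, by rw [inner_neg_left, huu]; norm_num, by rw [map_neg, sub_eq_add_neg]⟩

/-- **`DoubleStarCoaxialAt24 A₁ A₂`**: as `DoubleStarCoaxialAt`, but the eleventh ball `y` is assumed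
distinct from all 24 non-centre balls of the two predecessor clusters (the two predecessors and their
`2 × 12` slot translates other than `e`). -/
def DoubleStarCoaxialAt24 (A₁ A₂ : EuclideanSpace ℝ (Fin 3) ≃ₗᵢ[ℝ] EuclideanSpace ℝ (Fin 3)) : Prop :=
    ∀ u₁ ∈ fccSlots, ∀ u₂ ∈ fccSlots, ∀ (X : Finset (EuclideanSpace ℝ (Fin 3))),
      (∀ p ∈ X, ∀ q ∈ X, p ≠ q → 1 ≤ dist p q) →
      ∀ e ∈ X, e - A₁ u₁ ∈ X → (∀ w ∈ fccSlots, e - A₁ u₁ + A₁ w ∈ X) →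
        e - A₂ u₂ ∈ X → (∀ w ∈ fccSlots, e - A₂ u₂ + A₂ w ∈ X) →
        ∀ y ∈ X, dist e y = 1 →
          y ≠ e - A₁ u₁ → (∀ w ∈ fccSlots, y ≠ e - A₁ u₁ + A₁ w) →
          y ≠ e - A₂ u₂ → (∀ w ∈ fccSlots, y ≠ e - A₂ u₂ + A₂ w) →
          ∃ (L : EuclideanSpace ℝ (Fin 3) ≃ₗᵢ[ℝ] EuclideanSpace ℝ (Fin 3))
            (s₁ s₂ : EuclideanSpace ℝ (Fin 3)) (σ σ' : ℤ → ℤ), IsHaggSeq σ ∧ IsHaggSeq σ' ∧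
            A₁ '' fccStacking 1 (Real.sqrt (2 / 3)) ⊆
              (fun p => L p + s₁) '' barlowStacking 1 (Real.sqrt (2 / 3)) σ ∧
            A₂ '' fccStacking 1 (Real.sqrt (2 / 3)) ⊆
              (fun p => L p + s₂) '' barlowStacking 1 (Real.sqrt (2 / 3)) σ'

/-- **The 24-ball form implies the 10-star form** (they are equivalent; this is the direction the
chain ledger needs). -/
theorem doubleStarCoaxialAt_of_24 {A₁ A₂ : EuclideanSpace ℝ (Fin 3) ≃ₗᵢ[ℝ] EuclideanSpace ℝ (Fin 3)}
    (h : DoubleStarCoaxialAt24 A₁ A₂) : DoubleStarCoaxialAt A₁ A₂ := by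
  intro u₁ hu₁ u₂ hu₂ X hX e he hd₁ hf₁ hd₂ hf₂ y hy hyd hoff₁ hoff₂
  have offpred : ∀ (A : EuclideanSpace ℝ (Fin 3) ≃ₗᵢ[ℝ] EuclideanSpace ℝ (Fin 3)) (u : EuclideanSpace ℝ (Fin 3)),
      u ∈ fccSlots → (∀ w ∈ fccSlots, ⟪w, u⟫_ℝ < 0 → y ≠ e + A w) → y ≠ e - A u := by
    intro A u hu hoff hyu
    obtain ⟨hs, hneg, hform⟩ := pred_is_star A hu e
    exact hoff _ hs hneg (hyu.trans hform)
  have offclu : ∀ (A : EuclideanSpace ℝ (Fin 3) ≃ₗᵢ[ℝ] EuclideanSpace ℝ (Fin 3)) (u : EuclideanSpace ℝ (Fin 3)),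
      u ∈ fccSlots → (∀ w ∈ fccSlots, ⟪w, u⟫_ℝ < 0 → y ≠ e + A w) →
      ∀ w ∈ fccSlots, y ≠ e - A u + A w := by
    intro A u hu hoff w hw hyw
    have hd : dist e (e - A u + A w) = 1 := by rw [← hyw]; exact hyd
    obtain ⟨hs, hneg, hform⟩ := cluster_ball_at_dist_one_is_star A hu hw e hd
    exact hoff _ hs hneg (hyw.trans hform)
  exact h u₁ hu₁ u₂ hu₂ X hX e he hd₁ hf₁ hd₂ hf₂ y hy hyd (offpred A₁ u₁ hu₁ hoff₁)
    (offclu A₁ u₁ hu₁ hoff₁) (offpred A₂ u₂ hu₂ hoff₂) (offclu A₂ u₂ hu₂ hoff₂)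

end Summit.Ventures.Crystal3D.Theorems

end
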